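import Summits.BirchSwinnertonDyer.BirchSwinnertonDyer.Theorems.ByReductionTypeAtTwoAdditivePotMultConjATwoNarrowTwo6728Integers
import Summits.BirchSwinnertonDyer.BirchSwinnertonDyer.Theorems.ByReductionTypeAtTwoAdditivePotMultConjATwoNarrowTwo6728ParityOne
import Literature.NumberTheory.EllipticCurves.CyclotomicZpExtensionLayerGeneratorProofs
import HarnessLib

/-!
# C4″ `AdditivePotMultOverKAtTwo` (item stmt-BirchSwinnertonDyer-22618), the (I1M′) input of the upper half on the `0 < Δ` rows:
# LAYER-TWO NARROW CERTIFICATE `d = 6728` (S₃-CLOSURE ROAD), part PARITY — `h(A₂)` is ODD for `A₂ = ℚ(θ) ⊔ ℚ_2`, by genus theory for `A₂/A₁` with THREE ramified primes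
# and TWO independent dyadic non-norm units `ε₁`, `ε₂` (KERNEL; rows 121104ct1, 336400cb1)

Cell `bsd-2adic`, rung K4, seat `bsd-2adic-k4-w3` GEN 15 (explicit unit of director-bsd g16 (309)(7); `--supports stmt-BirchSwinnertonDyer-22618`).
HONEST FRAMING (D-0036/D-0054/D-0152): THEOREMS ONLY (no definition, no named fact, no `sorry`, no instance). The series `…NarrowTwo6728{Class, Field,
Dyadic, ParityOne, TotPos, Integers, Parity, SignsW…, Units, Row…}` is the S₃-CLOSURE ROAD of the layer-two narrow certificate: the totally real cubic
`2`-torsion field `E` of discriminant `6728 = 8·m²` (`X³ + (0)X² + (-29)X + (58)`) has Galois closure `A₁ = E(√2) = ℚ(θ) ⊔ ℚ_1` (group `S₃`), so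
`2 = (π₁π₂π₃)²` in `A₁` (three dyadic primes, `e = 2`, `f = 1`), `A₁/E` is ramified at ONE prime (⇒ `h(A₁)` odd with no unit condition) and
`A₂/A₁` (`A₂ = ℚ(θ) ⊔ ℚ_2 = E(√(2+√2))`) at THREE (⇒ `h(A₂)` odd from TWO independent dyadic non-norm units); `#(U⁺/U²)(A₁) ≥ 4` from two
totally positive units with three residue witnesses (ring maps `𝓞 A₁ → 𝓞 A₂ → 𝔽_ℓ`, k4-w2's `exists_ringHom_ringOfIntegers_sup_layer_two_zmod`),
TEN sign-independent units of `A₂` (with `−1`), k4-w2's Edgar–Mollin–Peterson door with `a = 2`, `b = 10`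
(`[Cl⁺(A₂):Cl⁺(A₂)²] = [Cl⁺(A₁):Cl⁺(A₁)²] = 4`), and cruxlead-19573-w2's rung `m = 1`; C4″ census rows 121104ct1, 336400cb1 (eng-2 CERT-ADD-POTMULT-POS81-AB-E2:
`rank₂ Cl⁺ = [1,2,2]`, `h = 1` at layers `0,1,2`, `n₀ = 1` — letter NARROW-EQUAL12, instrument grade `grh`; here KERNEL).
All certificates were found by the seat's exact-arithmetic tools (`k4w3/gen15/tools`: `s3explore`, `certs3`, GEN 13/14 `nf12/unitlib`) and are CHECKED HERE by the
kernel. Statement (A) is NOT BSD: BSD₂ for these curves is not proved; C4″ / (I1M′) stay research-open; nothing booked; no row of 22618 changes tier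
(pen RC-490 (4)); BSD is not proved by any of this.

References: [CoatesSujatha2005] Conj. A, Thm. 3.4; [Fukuda1994] Thm. 1 (2); [EdgarMollinPeterson1986] Thm. 2.1; [FrohlichTaylor1990] Ch. V §1 (1.8)–(1.13);
[Lang1990] Ch. 13 §4 Lemma 4.1; [Washington1997] §13.1, Prop. 13.2; [Cohen1993] §4.1.3, §6.3; [Marcus1977] Ch. 3 Thm. 27, Ch. 5 Thm. 22; [Omeara1963] §63.
-/

set_option autoImplicit false
-- sibling precedent: the directory name repeats the summit name
set_option linter.dupNamespace false

noncomputable section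

open scoped Classical IntermediateField NumberField nonZeroDivisors Polynomial

namespace Summit.BirchSwinnertonDyer.BirchSwinnertonDyer.Theorems.AddKatoTwo

open Polynomial IsDedekindDomain NumberField Field IntermediateField
  Literature.NumberTheory.EllipticCurves Literature.NumberTheory.EllipticCurves.ZpExtension
  Literature.NumberTheory.IwasawaTheory Literature.NumberTheory.NumberFields
  Literature.NumberTheory.GaloisRepresentations Literature.Geometry.Kaehler.ComplexTorus

variable {θ : AlgebraicClosure ℚ}

set_option linter.unusedSimpArgs false in
set_option maxHeartbeats 3200000 in
/-- **`h(ℚ(θ) ⊔ ℚ_2)` is ODD for `θ³ + (0)θ² + (-29)θ + (58) = 0`** (`A₂ = ℚ(θ, √(2+√2))`, the second cyclotomic layer of the cubic field of discriminant `6728 = 8m²`; S₃-closure road):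
genus theory for `A₂/A₁` — at most the THREE dyadic primes `(π₁)`, `(π₂)`, `(π₃)` of `A₁` ramify (`2 = v·π₁²π₂²π₃²`), no infinite place, `h(A₁)` odd, and the units
`ε₁ = -1 + 3 * θ - θ ^ 2`, `ε₂ = -13 + 10 * ω + 7 * θ - 4 * θ * ω - θ ^ 2` have `ε₁, ε₂, ε₁ε₂ ∉ N(A₂ˣ)` (dyadic Hilbert symbols `−1` at `π2`, `π1`, `π1`: the tree's
`not_exists_sq_sub_mul_sq_fractionRing_of_pow_four_dvd` applied to `ε·(a² − (2+√2)b²) ≡ 1 + πₖ⁴ (mod πₖ⁵)` for a suitable NORM `a² − (2+√2)b²`); the tree door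
`AmbiguousClass.odd_classNumber_of_quadratic_of_isTotallyReal_of_forall_sq_sub_mul_sq_ne₂`. KERNEL. [cite: Lang1990, Ch. 13 §4, Lemma 4.1 (PDF pp. 203–204)] [cite: Gras2003, IV.4 (genus theory)]
[cite: Omeara1963, §63B (63:10) and §63A (63:1)] [cite: Washington1997, §13.1] -/
theorem odd_classNumber_adjoin_sup_layer_two_d6728
    (hθ : aeval θ (Cubic.toPoly ⟨1, ((0 : ℤ) : ℚ), ((-29 : ℤ) : ℚ), ((58 : ℤ) : ℚ)⟩) = 0) :
    haveI : FiniteDimensional ℚ ↥ℚ⟮θ⟯ :=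
      IntermediateField.adjoin.finiteDimensional ⟨_, Cubic.monic_of_a_eq_one', by rwa [← aeval_def]⟩
    haveI : FiniteDimensional ℚ ↥((CyclotomicZp.zpExtension 2).layer 2) := (CyclotomicZp.zpExtension 2).finiteDimensional_layer_holds 2
    haveI : NumberField ↥(ℚ⟮θ⟯ ⊔ (CyclotomicZp.zpExtension 2).layer 2) := NumberField.mk
    Odd (classNumber ↥(ℚ⟮θ⟯ ⊔ (CyclotomicZp.zpExtension 2).layer 2)) := by
  haveI : FiniteDimensional ℚ ↥ℚ⟮θ⟯ :=
    IntermediateField.adjoin.finiteDimensional ⟨_, Cubic.monic_of_a_eq_one', by rwa [← aeval_def]⟩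
  haveI : FiniteDimensional ℚ ↥((CyclotomicZp.zpExtension 2).layer 1) := (CyclotomicZp.zpExtension 2).finiteDimensional_layer_holds 1
  haveI : FiniteDimensional ℚ ↥((CyclotomicZp.zpExtension 2).layer 2) := (CyclotomicZp.zpExtension 2).finiteDimensional_layer_holds 2
  haveI : NumberField ↥ℚ⟮θ⟯ := NumberField.mk
  haveI : NumberField ↥(ℚ⟮θ⟯ ⊔ (CyclotomicZp.zpExtension 2).layer 1) := NumberField.mk
  haveI : NumberField ↥(ℚ⟮θ⟯ ⊔ (CyclotomicZp.zpExtension 2).layer 2) := NumberField.mk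
  obtain ⟨hreal2, hfin2, h3⟩ := layer_two_basics irreducible_cubic_d6728p hθ (isTotallyReal_adjoin_d6728p hθ)
  obtain ⟨-, hfin1, -⟩ := layer_one_basics irreducible_cubic_d6728p hθ (isTotallyReal_adjoin_d6728p hθ)
  haveI := hreal2
  have hodd3 : Odd (Module.finrank ℚ ↥ℚ⟮θ⟯) := by rw [h3]; decide
  obtain ⟨e, he, -, he4⟩ := CyclotomicZp.exists_mem_layer_two_quartic_zpExtension
  have he0 : (fun x : AlgebraicClosure ℚ => x ^ 2 - 2)^[2] e = 0 := by
    simp only [Function.iterate_succ, Function.iterate_zero, Function.comp_apply, id_eq]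
    linear_combination he4
  obtain ⟨ht, ht2⟩ := sq_sub_two_mem_layer_one_d316 he0
  have hK1 : ℚ⟮θ⟯ ≤ ℚ⟮θ⟯ ⊔ (CyclotomicZp.zpExtension 2).layer 1 := le_sup_left
  have hK2 : ℚ⟮θ⟯ ≤ ℚ⟮θ⟯ ⊔ (CyclotomicZp.zpExtension 2).layer 2 := le_sup_left
  have h12 : ℚ⟮θ⟯ ⊔ (CyclotomicZp.zpExtension 2).layer 1 ≤ ℚ⟮θ⟯ ⊔ (CyclotomicZp.zpExtension 2).layer 2 :=
    sup_le_sup_left ((CyclotomicZp.zpExtension 2).layer_mono (by norm_num : 1 ≤ 2)) _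
  letI : Algebra ↥ℚ⟮θ⟯ ↥(ℚ⟮θ⟯ ⊔ (CyclotomicZp.zpExtension 2).layer 1) := (inclusion hK1).toRingHom.toAlgebra
  letI : Algebra ↥ℚ⟮θ⟯ ↥(ℚ⟮θ⟯ ⊔ (CyclotomicZp.zpExtension 2).layer 2) := (inclusion hK2).toRingHom.toAlgebra
  letI : Algebra ↥(ℚ⟮θ⟯ ⊔ (CyclotomicZp.zpExtension 2).layer 1) ↥(ℚ⟮θ⟯ ⊔ (CyclotomicZp.zpExtension 2).layer 2) :=
    (inclusion h12).toRingHom.toAlgebra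
  have halg12 : ∀ c, algebraMap ↥(ℚ⟮θ⟯ ⊔ (CyclotomicZp.zpExtension 2).layer 1) ↥(ℚ⟮θ⟯ ⊔ (CyclotomicZp.zpExtension 2).layer 2) c =
      inclusion h12 c := fun _ => rfl
  haveI : IsScalarTower ℚ ↥ℚ⟮θ⟯ ↥(ℚ⟮θ⟯ ⊔ (CyclotomicZp.zpExtension 2).layer 1) :=
    IsScalarTower.of_algebraMap_eq fun q => ((inclusion hK1).commutes q).symm
  haveI : IsScalarTower ℚ ↥ℚ⟮θ⟯ ↥(ℚ⟮θ⟯ ⊔ (CyclotomicZp.zpExtension 2).layer 2) :=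
    IsScalarTower.of_algebraMap_eq fun q => ((inclusion hK2).commutes q).symm
  haveI : IsScalarTower ℚ ↥(ℚ⟮θ⟯ ⊔ (CyclotomicZp.zpExtension 2).layer 1) ↥(ℚ⟮θ⟯ ⊔ (CyclotomicZp.zpExtension 2).layer 2) :=
    IsScalarTower.of_algebraMap_eq fun q => ((inclusion h12).commutes q).symm
  haveI : IsScalarTower ↥ℚ⟮θ⟯ ↥(ℚ⟮θ⟯ ⊔ (CyclotomicZp.zpExtension 2).layer 1) ↥(ℚ⟮θ⟯ ⊔ (CyclotomicZp.zpExtension 2).layer 2) :=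
    IsScalarTower.of_algebraMap_eq fun _ => rfl
  haveI : Module.Finite ↥ℚ⟮θ⟯ ↥(ℚ⟮θ⟯ ⊔ (CyclotomicZp.zpExtension 2).layer 1) := Module.Finite.of_restrictScalars_finite ℚ ↥ℚ⟮θ⟯ _
  haveI : Module.Finite ↥ℚ⟮θ⟯ ↥(ℚ⟮θ⟯ ⊔ (CyclotomicZp.zpExtension 2).layer 2) := Module.Finite.of_restrictScalars_finite ℚ ↥ℚ⟮θ⟯ _
  haveI : Module.Finite ↥(ℚ⟮θ⟯ ⊔ (CyclotomicZp.zpExtension 2).layer 1) ↥(ℚ⟮θ⟯ ⊔ (CyclotomicZp.zpExtension 2).layer 2) :=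
    Module.Finite.of_restrictScalars_finite ℚ _ _
  have hdegK1 : Module.finrank ↥ℚ⟮θ⟯ ↥(ℚ⟮θ⟯ ⊔ (CyclotomicZp.zpExtension 2).layer 1) = 2 := by
    have htower := Module.finrank_mul_finrank ℚ ↥ℚ⟮θ⟯ ↥(ℚ⟮θ⟯ ⊔ (CyclotomicZp.zpExtension 2).layer 1)
    rw [h3, hfin1] at htower
    omega
  have hdeg12 : Module.finrank ↥(ℚ⟮θ⟯ ⊔ (CyclotomicZp.zpExtension 2).layer 1) ↥(ℚ⟮θ⟯ ⊔ (CyclotomicZp.zpExtension 2).layer 2) = 2 := by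
    have htower := Module.finrank_mul_finrank ℚ ↥(ℚ⟮θ⟯ ⊔ (CyclotomicZp.zpExtension 2).layer 1) ↥(ℚ⟮θ⟯ ⊔ (CyclotomicZp.zpExtension 2).layer 2)
    rw [hfin1, hfin2] at htower
    omega
  haveI : Algebra.IsQuadraticExtension ↥(ℚ⟮θ⟯ ⊔ (CyclotomicZp.zpExtension 2).layer 1) ↥(ℚ⟮θ⟯ ⊔ (CyclotomicZp.zpExtension 2).layer 2) :=
    ⟨hdeg12⟩
  haveI : IsGalois ↥(ℚ⟮θ⟯ ⊔ (CyclotomicZp.zpExtension 2).layer 1) ↥(ℚ⟮θ⟯ ⊔ (CyclotomicZp.zpExtension 2).layer 2) := inferInstance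
  have heA : e ∈ ℚ⟮θ⟯ ⊔ (CyclotomicZp.zpExtension 2).layer 2 := (le_sup_right : (CyclotomicZp.zpExtension 2).layer 2 ≤ _) he
  have htA : e ^ 2 - 2 ∈ ℚ⟮θ⟯ ⊔ (CyclotomicZp.zpExtension 2).layer 1 := (le_sup_right : (CyclotomicZp.zpExtension 2).layer 1 ≤ _) ht
  set e' : ↥(ℚ⟮θ⟯ ⊔ (CyclotomicZp.zpExtension 2).layer 2) := ⟨e, heA⟩ with he'def
  set t' : ↥(ℚ⟮θ⟯ ⊔ (CyclotomicZp.zpExtension 2).layer 1) := ⟨e ^ 2 - 2, htA⟩ with ht'def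
  have he'0 : (fun x : ↥(ℚ⟮θ⟯ ⊔ (CyclotomicZp.zpExtension 2).layer 2) => x ^ 2 - 2)^[2] e' = 0 := by
    apply (algebraMap ↥(ℚ⟮θ⟯ ⊔ (CyclotomicZp.zpExtension 2).layer 2) (AlgebraicClosure ℚ)).injective
    rw [NestedSqrtTwo.map_iterate, map_zero]
    exact he0
  have hs : e' ^ 2 = algebraMap ↥(ℚ⟮θ⟯ ⊔ (CyclotomicZp.zpExtension 2).layer 1) ↥(ℚ⟮θ⟯ ⊔ (CyclotomicZp.zpExtension 2).layer 2) (2 + t') := by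
    apply (algebraMap ↥(ℚ⟮θ⟯ ⊔ (CyclotomicZp.zpExtension 2).layer 2) (AlgebraicClosure ℚ)).injective
    rw [halg12]
    change e ^ 2 = 2 + (e ^ 2 - 2)
    ring
  have hsK : e' ∉ Set.range (algebraMap ↥(ℚ⟮θ⟯ ⊔ (CyclotomicZp.zpExtension 2).layer 1) ↥(ℚ⟮θ⟯ ⊔ (CyclotomicZp.zpExtension 2).layer 2)) := by
    rintro ⟨c, hc⟩
    have h4 : (minpoly ↥ℚ⟮θ⟯ e').natDegree = 4 := by
      rw [NestedSqrtTwo.minpoly_eq_of_odd_finrank hodd3 e' he'0, NestedSqrtTwo.natDegree_eq]; norm_num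
    rw [← hc, minpoly.algebraMap_eq (algebraMap ↥(ℚ⟮θ⟯ ⊔ (CyclotomicZp.zpExtension 2).layer 1)
      ↥(ℚ⟮θ⟯ ⊔ (CyclotomicZp.zpExtension 2).layer 2)).injective] at h4
    have hle := minpoly.natDegree_le (A := ↥ℚ⟮θ⟯) c
    rw [h4, hdegK1] at hle
    omega
  -- layer-1 integers, the three dyadic primes and the two non-norm units
  obtain ⟨bA, xA, sA, hbAval, hsAval, -, RbA, RxA, hsS, hsA2, ⟨hprime1, hres1, hnw1, hnμ1, hP1⟩, ⟨hprime2, hres2, hnw2, hnμ2, hP2⟩, ⟨hprime3, hres3, hnw3, hnμ3, hP3⟩⟩ :=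
    layer_one_dyadic_d6728 hθ ht ht2
  obtain ⟨-, htwo1, -, hdelta1, -, htwo2, -, hdelta2, -, htwo3, -, hdelta3, -, htwo, hvinv, -, -, -, -, -, -⟩ := layer_one_ids_d6728 bA xA RbA RxA
  obtain ⟨heps1inv, heps2inv, hnn_e1, hnnk_e1, hnn_e2, hnnk_e2, hnn_e12, hnnk_e12, -, -⟩ := layer_one_unit_ids_d6728 bA xA RbA RxA
  set ε₁ : (𝓞 ↥(ℚ⟮θ⟯ ⊔ (CyclotomicZp.zpExtension 2).layer 1))ˣ := Units.mkOfMulEqOne _ _ heps1inv with hε₁def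
  set ε₂ : (𝓞 ↥(ℚ⟮θ⟯ ⊔ (CyclotomicZp.zpExtension 2).layer 1))ˣ := Units.mkOfMulEqOne _ _ heps2inv with hε₂def
  have hε₁val : ((ε₁ : 𝓞 ↥(ℚ⟮θ⟯ ⊔ (CyclotomicZp.zpExtension 2).layer 1)) : ↥(ℚ⟮θ⟯ ⊔ (CyclotomicZp.zpExtension 2).layer 1)) = ((-1 + 3 * bA - bA ^ 2 : 𝓞 ↥(ℚ⟮θ⟯ ⊔ (CyclotomicZp.zpExtension 2).layer 1)) : ↥(ℚ⟮θ⟯ ⊔ (CyclotomicZp.zpExtension 2).layer 1)) := by rw [hε₁def, Units.val_mkOfMulEqOne]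
  have hε₂val : ((ε₂ : 𝓞 ↥(ℚ⟮θ⟯ ⊔ (CyclotomicZp.zpExtension 2).layer 1)) : ↥(ℚ⟮θ⟯ ⊔ (CyclotomicZp.zpExtension 2).layer 1)) = ((-13 + 10 * xA + 7 * bA - 4 * bA * xA - bA ^ 2 : 𝓞 ↥(ℚ⟮θ⟯ ⊔ (CyclotomicZp.zpExtension 2).layer 1)) : ↥(ℚ⟮θ⟯ ⊔ (CyclotomicZp.zpExtension 2).layer 1)) := by rw [hε₂def, Units.val_mkOfMulEqOne]
  have hsAval' : (sA : ↥(ℚ⟮θ⟯ ⊔ (CyclotomicZp.zpExtension 2).layer 1)) = t' := hsAval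
  have hK : Odd (classNumber ↥(ℚ⟮θ⟯ ⊔ (CyclotomicZp.zpExtension 2).layer 1)) := odd_classNumber_adjoin_sup_layer_one_d6728 hθ
  -- the non-norm certificates: `ε·(a² − (2+t)b²) − 1 = πₖ⁴κ`, `κ ≡ 1 (mod πₖ)`, so `x² − (2+t)y² ≠ ε·(a² − (2+t)b²)` and hence `≠ ε`
  have hone : ∀ {π y z : 𝓞 ↥(ℚ⟮θ⟯ ⊔ (CyclotomicZp.zpExtension 2).layer 1)}, Prime π → y - 1 = π * z → ¬ π ∣ y := by
    rintro π y z hπ hyz ⟨c, hc⟩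
    exact hπ.not_unit (isUnit_of_dvd_one ⟨c - z, by linear_combination hc - hyz⟩)
  have hnn : ∀ (π W M U Aa Bb κ ν : 𝓞 ↥(ℚ⟮θ⟯ ⊔ (CyclotomicZp.zpExtension 2).layer 1)), Prime π → (2 : 𝓞 ↥(ℚ⟮θ⟯ ⊔ (CyclotomicZp.zpExtension 2).layer 1)) = π ^ 2 * W → ¬ π ∣ W →
      (∀ z : 𝓞 ↥(ℚ⟮θ⟯ ⊔ (CyclotomicZp.zpExtension 2).layer 1), π ∣ z ∨ π ∣ z - 1) → π * M = 2 + (-35 - 147 * xA + 7 * bA + 32 * bA * xA + 2 * bA ^ 2 + 9 * bA ^ 2 * xA) → ¬ π ∣ M →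
      U * (Aa ^ 2 - (2 + (-35 - 147 * xA + 7 * bA + 32 * bA * xA + 2 * bA ^ 2 + 9 * bA ^ 2 * xA)) * Bb ^ 2) - 1 = π ^ 4 * κ → κ - 1 = π * ν →
      ∀ a c : ↥(ℚ⟮θ⟯ ⊔ (CyclotomicZp.zpExtension 2).layer 1), a ^ 2 - (2 + t') * c ^ 2 ≠ ((U : 𝓞 ↥(ℚ⟮θ⟯ ⊔ (CyclotomicZp.zpExtension 2).layer 1)) : ↥(ℚ⟮θ⟯ ⊔ (CyclotomicZp.zpExtension 2).layer 1)) := by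
    intro π W M U Aa Bb κ ν hπ h2 hnw hres hδ hnμ h4 h5 a c h
    rw [hsS] at hδ h4
    have h4' : π ^ 4 ∣ U * (Aa ^ 2 - (2 + sA) * Bb ^ 2) - 1 := ⟨κ, h4⟩
    have h5' : ¬ π ^ 5 ∣ U * (Aa ^ 2 - (2 + sA) * Bb ^ 2) - 1 := by
      intro hd
      rw [h4, show π ^ 5 = π ^ 4 * π ^ 1 by ring] at hd
      have hd' : π ^ 1 ∣ κ := (mul_dvd_mul_iff_left (pow_ne_zero 4 hπ.ne_zero)).mp hd
      rw [pow_one] at hd'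
      exact hone hπ h5 hd'
    have key := not_exists_sq_sub_mul_sq_fractionRing_of_pow_four_dvd (↥(ℚ⟮θ⟯ ⊔ (CyclotomicZp.zpExtension 2).layer 1)) hπ h2 hnw hres hnμ h4' h5'
    apply key
    refine ⟨a * ((Aa : 𝓞 ↥(ℚ⟮θ⟯ ⊔ (CyclotomicZp.zpExtension 2).layer 1)) : ↥(ℚ⟮θ⟯ ⊔ (CyclotomicZp.zpExtension 2).layer 1)) + (2 + t') * c * ((Bb : 𝓞 ↥(ℚ⟮θ⟯ ⊔ (CyclotomicZp.zpExtension 2).layer 1)) : ↥(ℚ⟮θ⟯ ⊔ (CyclotomicZp.zpExtension 2).layer 1)), a * ((Bb : 𝓞 ↥(ℚ⟮θ⟯ ⊔ (CyclotomicZp.zpExtension 2).layer 1)) : ↥(ℚ⟮θ⟯ ⊔ (CyclotomicZp.zpExtension 2).layer 1)) + c * ((Aa : 𝓞 ↥(ℚ⟮θ⟯ ⊔ (CyclotomicZp.zpExtension 2).layer 1)) : ↥(ℚ⟮θ⟯ ⊔ (CyclotomicZp.zpExtension 2).layer 1)), ?_⟩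
    have hδ' : algebraMap (𝓞 ↥(ℚ⟮θ⟯ ⊔ (CyclotomicZp.zpExtension 2).layer 1)) ↥(ℚ⟮θ⟯ ⊔ (CyclotomicZp.zpExtension 2).layer 1) (π * M) = 2 + t' := by
      rw [hδ, map_add, map_ofNat, ← NumberField.RingOfIntegers.coe_eq_algebraMap, hsAval']
    rw [hδ']
    simp only [map_sub, map_mul, map_add, map_pow, map_ofNat, map_one, ← NumberField.RingOfIntegers.coe_eq_algebraMap, hsAval']
    linear_combination ((((Aa : 𝓞 ↥(ℚ⟮θ⟯ ⊔ (CyclotomicZp.zpExtension 2).layer 1)) : ↥(ℚ⟮θ⟯ ⊔ (CyclotomicZp.zpExtension 2).layer 1))) ^ 2 - (2 + t') * (((Bb : 𝓞 ↥(ℚ⟮θ⟯ ⊔ (CyclotomicZp.zpExtension 2).layer 1)) : ↥(ℚ⟮θ⟯ ⊔ (CyclotomicZp.zpExtension 2).layer 1))) ^ 2) * h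
  have hne₁ : ∀ a c : ↥(ℚ⟮θ⟯ ⊔ (CyclotomicZp.zpExtension 2).layer 1), a ^ 2 - (2 + t') * c ^ 2 ≠ ((ε₁ : 𝓞 ↥(ℚ⟮θ⟯ ⊔ (CyclotomicZp.zpExtension 2).layer 1)) : ↥(ℚ⟮θ⟯ ⊔ (CyclotomicZp.zpExtension 2).layer 1)) := by
    rw [hε₁val]; exact hnn (-31 - 194 * xA + 7 * bA + 43 * bA * xA + 2 * bA ^ 2 + 12 * bA ^ 2 * xA) (-542 - 4176 * xA + 154 * bA + 930 * bA * xA + 39 * bA ^ 2 + 259 * bA ^ 2 * xA) (-247 - 1137 * xA + 53 * bA + 250 * bA * xA + 15 * bA ^ 2 + 70 * bA ^ 2 * xA) (-1 + 3 * bA - bA ^ 2) (-1) (-1) _ _ hprime2 htwo2.symm hnw2 hres2 hdelta2 hnμ2 hnn_e1 hnnk_e1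
  have hne₂ : ∀ a c : ↥(ℚ⟮θ⟯ ⊔ (CyclotomicZp.zpExtension 2).layer 1), a ^ 2 - (2 + t') * c ^ 2 ≠ ((ε₂ : 𝓞 ↥(ℚ⟮θ⟯ ⊔ (CyclotomicZp.zpExtension 2).layer 1)) : ↥(ℚ⟮θ⟯ ⊔ (CyclotomicZp.zpExtension 2).layer 1)) := by
    rw [hε₂val]; exact hnn (27 + 241 * xA - 8 * bA - 54 * bA * xA - 2 * bA ^ 2 - 15 * bA ^ 2 * xA) (9 - 6 * bA + bA ^ 2) (14 + 81 * xA - 3 * bA - 18 * bA * xA - bA ^ 2 - 5 * bA ^ 2 * xA) (-13 + 10 * xA + 7 * bA - 4 * bA * xA - bA ^ 2) (34 + 147 * xA - 7 * bA - 32 * bA * xA - 2 * bA ^ 2 - 9 * bA ^ 2 * xA) (0) _ _ hprime1 htwo1.symm hnw1 hres1 hdelta1 hnμ1 hnn_e2 hnnk_e2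
  have hU12 : ((593 - 242 * xA - 394 * bA + 150 * bA * xA + 64 * bA ^ 2 - 22 * bA ^ 2 * xA) : 𝓞 ↥(ℚ⟮θ⟯ ⊔ (CyclotomicZp.zpExtension 2).layer 1)) = (-1 + 3 * bA - bA ^ 2) * (-13 + 10 * xA + 7 * bA - 4 * bA * xA - bA ^ 2) := by
    linear_combination ((0 : 𝓞 ↥(ℚ⟮θ⟯ ⊔ (CyclotomicZp.zpExtension 2).layer 1))) * RxA + ((10 : 𝓞 ↥(ℚ⟮θ⟯ ⊔ (CyclotomicZp.zpExtension 2).layer 1)) + (-4 : 𝓞 ↥(ℚ⟮θ⟯ ⊔ (CyclotomicZp.zpExtension 2).layer 1)) * xA + (-1 : 𝓞 ↥(ℚ⟮θ⟯ ⊔ (CyclotomicZp.zpExtension 2).layer 1)) * bA) * RbA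
  have hne₁₂ : ∀ a c : ↥(ℚ⟮θ⟯ ⊔ (CyclotomicZp.zpExtension 2).layer 1), a ^ 2 - (2 + t') * c ^ 2 ≠ ((ε₁ : 𝓞 ↥(ℚ⟮θ⟯ ⊔ (CyclotomicZp.zpExtension 2).layer 1)) : ↥(ℚ⟮θ⟯ ⊔ (CyclotomicZp.zpExtension 2).layer 1)) * ((ε₂ : 𝓞 ↥(ℚ⟮θ⟯ ⊔ (CyclotomicZp.zpExtension 2).layer 1)) : ↥(ℚ⟮θ⟯ ⊔ (CyclotomicZp.zpExtension 2).layer 1)) := by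
    rw [hε₁val, hε₂val, ← map_mul, ← hU12]; exact hnn (27 + 241 * xA - 8 * bA - 54 * bA * xA - 2 * bA ^ 2 - 15 * bA ^ 2 * xA) (9 - 6 * bA + bA ^ 2) (14 + 81 * xA - 3 * bA - 18 * bA * xA - bA ^ 2 - 5 * bA ^ 2 * xA) (593 - 242 * xA - 394 * bA + 150 * bA * xA + 64 * bA ^ 2 - 22 * bA ^ 2 * xA) (34 + 147 * xA - 7 * bA - 32 * bA * xA - 2 * bA ^ 2 - 9 * bA ^ 2 * xA) (0) _ _ hprime1 htwo1.symm hnw1 hres1 hdelta1 hnμ1 hnn_e12 hnnk_e12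
  -- the integer `e` of `A₂`: `e² = 2 + t`, `A₂ = A₁[e]`
  set sB : 𝓞 ↥(ℚ⟮θ⟯ ⊔ (CyclotomicZp.zpExtension 2).layer 2) := ⟨e', NestedSqrtTwo.isIntegral he'0⟩ with hsBdef
  have hsBval : algebraMap (𝓞 ↥(ℚ⟮θ⟯ ⊔ (CyclotomicZp.zpExtension 2).layer 2)) ↥(ℚ⟮θ⟯ ⊔ (CyclotomicZp.zpExtension 2).layer 2) sB = e' := rfl
  have hsB2 : sB ^ 2 = algebraMap (𝓞 ↥(ℚ⟮θ⟯ ⊔ (CyclotomicZp.zpExtension 2).layer 1)) (𝓞 ↥(ℚ⟮θ⟯ ⊔ (CyclotomicZp.zpExtension 2).layer 2)) (2 + sA) := by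
    apply NumberField.RingOfIntegers.coe_injective
    rw [map_pow, hsBval, hs,
      ← IsScalarTower.algebraMap_apply (𝓞 ↥(ℚ⟮θ⟯ ⊔ (CyclotomicZp.zpExtension 2).layer 1)) (𝓞 ↥(ℚ⟮θ⟯ ⊔ (CyclotomicZp.zpExtension 2).layer 2))
        ↥(ℚ⟮θ⟯ ⊔ (CyclotomicZp.zpExtension 2).layer 2),
      IsScalarTower.algebraMap_apply (𝓞 ↥(ℚ⟮θ⟯ ⊔ (CyclotomicZp.zpExtension 2).layer 1)) ↥(ℚ⟮θ⟯ ⊔ (CyclotomicZp.zpExtension 2).layer 1)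
        ↥(ℚ⟮θ⟯ ⊔ (CyclotomicZp.zpExtension 2).layer 2), map_add, map_ofNat]
    change _ = algebraMap _ _ (2 + (sA : ↥(ℚ⟮θ⟯ ⊔ (CyclotomicZp.zpExtension 2).layer 1)))
    rw [hsAval', map_add, map_ofNat]
  have htint : IsIntegral ↥(ℚ⟮θ⟯ ⊔ (CyclotomicZp.zpExtension 2).layer 1) e' := (Algebra.IsIntegral.isIntegral (R := ℚ) e').tower_top
  have hgen : IntermediateField.adjoin ↥(ℚ⟮θ⟯ ⊔ (CyclotomicZp.zpExtension 2).layer 1) ({e'} : Set ↥(ℚ⟮θ⟯ ⊔ (CyclotomicZp.zpExtension 2).layer 2)) = ⊤ := by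
    have h2le : 2 ≤ (minpoly ↥(ℚ⟮θ⟯ ⊔ (CyclotomicZp.zpExtension 2).layer 1) e').natDegree := (minpoly.two_le_natDegree_iff htint).mpr hsK
    refine IntermediateField.eq_of_le_of_finrank_eq le_top ?_
    rw [IntermediateField.adjoin.finrank htint, IntermediateField.finrank_top', hdeg12]
    exact le_antisymm ((minpoly.natDegree_le (A := ↥(ℚ⟮θ⟯ ⊔ (CyclotomicZp.zpExtension 2).layer 1)) (x := e')).trans hdeg12.le) h2le
  have hgenB : Algebra.adjoin ↥(ℚ⟮θ⟯ ⊔ (CyclotomicZp.zpExtension 2).layer 1) ({(sB : ↥(ℚ⟮θ⟯ ⊔ (CyclotomicZp.zpExtension 2).layer 2))} :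
      Set ↥(ℚ⟮θ⟯ ⊔ (CyclotomicZp.zpExtension 2).layer 2)) = ⊤ := by
    rw [← NumberField.RingOfIntegers.coe_eq_algebraMap] at hsBval
    rw [hsBval, ← IntermediateField.adjoin_simple_toSubalgebra_of_isAlgebraic htint.isAlgebraic, hgen, IntermediateField.top_toSubalgebra]
  -- at most the three dyadic primes `(π₁)`, `(π₂)`, `(π₃)` of `A₁` ramify in `A₂`
  have hvunit : IsUnit ((1) : 𝓞 ↥(ℚ⟮θ⟯ ⊔ (CyclotomicZp.zpExtension 2).layer 1)) := IsUnit.of_mul_eq_one _ hvinv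
  have hram : (∏ᶠ v : HeightOneSpectrum (𝓞 ↥(ℚ⟮θ⟯ ⊔ (CyclotomicZp.zpExtension 2).layer 1)),
      v.asIdeal.ramificationIdxIn (𝓞 ↥(ℚ⟮θ⟯ ⊔ (CyclotomicZp.zpExtension 2).layer 2))) ∣ 8 := by
    rw [AmbiguousClass.finprod_ramificationIdxIn_eq_pow_of_prime Nat.prime_two hdeg12]
    set w1 : HeightOneSpectrum (𝓞 ↥(ℚ⟮θ⟯ ⊔ (CyclotomicZp.zpExtension 2).layer 1)) := ⟨Ideal.span {(27 + 241 * xA - 8 * bA - 54 * bA * xA - 2 * bA ^ 2 - 15 * bA ^ 2 * xA : 𝓞 ↥(ℚ⟮θ⟯ ⊔ (CyclotomicZp.zpExtension 2).layer 1))}, hP1, by rw [Ne, Ideal.span_singleton_eq_bot]; exact hprime1.ne_zero⟩ with hw1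
    set w2 : HeightOneSpectrum (𝓞 ↥(ℚ⟮θ⟯ ⊔ (CyclotomicZp.zpExtension 2).layer 1)) := ⟨Ideal.span {(-31 - 194 * xA + 7 * bA + 43 * bA * xA + 2 * bA ^ 2 + 12 * bA ^ 2 * xA : 𝓞 ↥(ℚ⟮θ⟯ ⊔ (CyclotomicZp.zpExtension 2).layer 1))}, hP2, by rw [Ne, Ideal.span_singleton_eq_bot]; exact hprime2.ne_zero⟩ with hw2
    set w3 : HeightOneSpectrum (𝓞 ↥(ℚ⟮θ⟯ ⊔ (CyclotomicZp.zpExtension 2).layer 1)) := ⟨Ideal.span {(31 + 194 * xA - 8 * bA - 43 * bA * xA - 2 * bA ^ 2 - 12 * bA ^ 2 * xA : 𝓞 ↥(ℚ⟮θ⟯ ⊔ (CyclotomicZp.zpExtension 2).layer 1))}, hP3, by rw [Ne, Ideal.span_singleton_eq_bot]; exact hprime3.ne_zero⟩ with hw3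
    have hsub : {v : HeightOneSpectrum (𝓞 ↥(ℚ⟮θ⟯ ⊔ (CyclotomicZp.zpExtension 2).layer 1)) |
        v.asIdeal.ramificationIdxIn (𝓞 ↥(ℚ⟮θ⟯ ⊔ (CyclotomicZp.zpExtension 2).layer 2)) ≠ 1} ⊆ {w1, w2, w3} := by
      intro v hv
      rw [Set.mem_setOf_eq] at hv
      have h2v : (2 : 𝓞 ↥(ℚ⟮θ⟯ ⊔ (CyclotomicZp.zpExtension 2).layer 1)) ∈ v.asIdeal := by
        by_contra h2
        apply hv
        haveI := v.isMaximal
        obtain ⟨Q, hQmax, hQover⟩ := Ideal.exists_maximal_ideal_liesOver_of_isIntegral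
          (S := 𝓞 ↥(ℚ⟮θ⟯ ⊔ (CyclotomicZp.zpExtension 2).layer 2)) v.asIdeal
        haveI := hQmax
        haveI := hQover
        rw [Ideal.ramificationIdxIn_eq_ramificationIdx v.asIdeal Q
          (↥(ℚ⟮θ⟯ ⊔ (CyclotomicZp.zpExtension 2).layer 2) ≃ₐ[↥(ℚ⟮θ⟯ ⊔ (CyclotomicZp.zpExtension 2).layer 1)]
            ↥(ℚ⟮θ⟯ ⊔ (CyclotomicZp.zpExtension 2).layer 2))]
        have hunr : Algebra.IsUnramifiedAt (𝓞 ↥(ℚ⟮θ⟯ ⊔ (CyclotomicZp.zpExtension 2).layer 1)) Q := by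
          refine isUnramifiedAt_of_sq_eq hsB2 hgenB Q fun hmem => h2 ?_
          have hu : 4 * (2 + sA) ∈ Q.under (𝓞 ↥(ℚ⟮θ⟯ ⊔ (CyclotomicZp.zpExtension 2).layer 1)) := by
            rw [Ideal.under_def, Ideal.mem_comap]; exact hmem
          rw [← Ideal.over_def Q v.asIdeal] at hu
          rcases v.isPrime.mem_or_mem hu with h | h
          · have h22 : (4 : 𝓞 ↥(ℚ⟮θ⟯ ⊔ (CyclotomicZp.zpExtension 2).layer 1)) = 2 * 2 := by norm_num
            rw [h22] at h
            exact (v.isPrime.mem_or_mem h).elim id id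
          · have h2' : (2 + sA) * (2 - sA) ∈ v.asIdeal := v.asIdeal.mul_mem_right _ h
            have heq : (2 + sA) * (2 - sA) = (2 : 𝓞 ↥(ℚ⟮θ⟯ ⊔ (CyclotomicZp.zpExtension 2).layer 1)) := by
              linear_combination (-1 : 𝓞 ↥(ℚ⟮θ⟯ ⊔ (CyclotomicZp.zpExtension 2).layer 1)) * hsA2
            rwa [heq] at h2'
        exact Ideal.ramificationIdx_eq_one_iff.mpr hunr
      rw [htwo.symm] at h2v
      have hπ : (27 + 241 * xA - 8 * bA - 54 * bA * xA - 2 * bA ^ 2 - 15 * bA ^ 2 * xA) ∈ v.asIdeal ∨ (-31 - 194 * xA + 7 * bA + 43 * bA * xA + 2 * bA ^ 2 + 12 * bA ^ 2 * xA) ∈ v.asIdeal ∨ (31 + 194 * xA - 8 * bA - 43 * bA * xA - 2 * bA ^ 2 - 12 * bA ^ 2 * xA) ∈ v.asIdeal := by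
        rcases v.isPrime.mem_or_mem h2v with h | h
        · rcases v.isPrime.mem_or_mem h with h' | h'
          · rcases v.isPrime.mem_or_mem h' with hu | hp
            · exact absurd (Ideal.eq_top_of_isUnit_mem _ hu hvunit) v.isPrime.ne_top
            · exact Or.inl (v.isPrime.mem_of_pow_mem 2 hp)
          · exact Or.inr (Or.inl (v.isPrime.mem_of_pow_mem 2 h'))
        · exact Or.inr (Or.inr (v.isPrime.mem_of_pow_mem 2 h))
      simp only [Set.mem_insert_iff, Set.mem_singleton_iff]
      rcases hπ with h | h | h
      · left
        apply HeightOneSpectrum.ext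
        exact ((hP1.isMaximal (by rw [Ne, Ideal.span_singleton_eq_bot]; exact hprime1.ne_zero)).eq_of_le v.isPrime.ne_top ((Ideal.span_singleton_le_iff_mem _).mpr h)).symm
      · right; left
        apply HeightOneSpectrum.ext
        exact ((hP2.isMaximal (by rw [Ne, Ideal.span_singleton_eq_bot]; exact hprime2.ne_zero)).eq_of_le v.isPrime.ne_top ((Ideal.span_singleton_le_iff_mem _).mpr h)).symm
      · right; right
        apply HeightOneSpectrum.ext
        exact ((hP3.isMaximal (by rw [Ne, Ideal.span_singleton_eq_bot]; exact hprime3.ne_zero)).eq_of_le v.isPrime.ne_top ((Ideal.span_singleton_le_iff_mem _).mpr h)).symm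
    have hle : {v : HeightOneSpectrum (𝓞 ↥(ℚ⟮θ⟯ ⊔ (CyclotomicZp.zpExtension 2).layer 1)) |
        v.asIdeal.ramificationIdxIn (𝓞 ↥(ℚ⟮θ⟯ ⊔ (CyclotomicZp.zpExtension 2).layer 2)) ≠ 1}.ncard ≤ 3 := by
      refine (Set.ncard_le_ncard hsub (Set.toFinite _)).trans ?_
      exact (Set.ncard_insert_le w1 {w2, w3}).trans (by linarith [Set.ncard_insert_le w2 ({w3} : Set (HeightOneSpectrum (𝓞 ↥(ℚ⟮θ⟯ ⊔ (CyclotomicZp.zpExtension 2).layer 1)))), (Set.ncard_singleton w3).le])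
    calc 2 ^ {v : HeightOneSpectrum (𝓞 ↥(ℚ⟮θ⟯ ⊔ (CyclotomicZp.zpExtension 2).layer 1)) |
          v.asIdeal.ramificationIdxIn (𝓞 ↥(ℚ⟮θ⟯ ⊔ (CyclotomicZp.zpExtension 2).layer 2)) ≠ 1}.ncard ∣ 2 ^ 3 := pow_dvd_pow 2 hle
      _ = 8 := by norm_num
  exact AmbiguousClass.odd_classNumber_of_quadratic_of_isTotallyReal_of_forall_sq_sub_mul_sq_ne₂ hdeg12 hram hs hsK ε₁ ε₂ hne₁ hne₂ hne₁₂ hK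

end Summit.BirchSwinnertonDyer.BirchSwinnertonDyer.Theorems.AddKatoTwo

end
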